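import Mathlib
import Summits.Ventures.PercRepro2.KPrimeBernsteinStep
import Summits.Ventures.PercRepro2.KPrimePendantMark

/-!
# The root `a₂` on a leaf: the Bernstein split in the vocabulary of the `z`-instance
(blind cell PercRepro2, mine-c g42; `conjectures/MINE-C.md` §51.4)

Let the root `a₂` be a LEAF whose only edge is `e = {a₂, z}` (weight `t = p e`; `z` and the other
marks `≠ a₂`).  With `e` pinned CLOSED `a₂` is isolated: `Ω = S =` everything, `Y = ∅`, `N = {v ∉ C₁}`,
and the ten masses are the ISOLATED vector `isoMasses` (`P(U∩X), P(U), P(Uᶜ), P(X∩Uᶜ), 0, 1,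
P(Uᶜ∩W∩(X ∪ C_v)), P(Uᶜ∩W), 0, 0`).  With `e` pinned OPEN `a₂` is connected exactly to what `z`
is connected to, and the ten masses are those of the `z`-INSTANCE (the same graph with `z` in
the role of `a₂`), which are flip-invariant at `e`.  The one-edge Bernstein split of
`KPrimeBernsteinStep.lean` then reads

  `kprimeForm(a₂-instance, p) = (1 − t)³ F₀ + t (1 − t)² G₁ + t² (1 − t) G₂ + t³ F₁`

with `F₀ = kformTri M⁰ M⁰ M⁰` the isolated form (`P(Uᶜ∩W∩Xᵉ) P(Uᶜ) − P(X∩Uᶜ) P(Uᶜ∩W)`),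
`F₁ = kprimeForm(z-instance)`, `G₁ = mixedOne M⁰ M¹`, `G₂ = mixedTwo M⁰ M¹`
(`kprimeForm_rootLeaf_a₂`), and `(K′)` with `a₂` on the leaf follows from `(K′)` at the
`z`-instance and the non-negativity of `F₀, G₁, G₂` (`kprime_of_rootLeaf_a₂`) — the root-leaf
case of `MINE-C.md` §51, where on `C₅` the three are tensor-Bernstein certificates.
-/

namespace Summit.Ventures.PercRepro2

namespace KPrime

variable {V : Type*} {E : Type*} [Fintype E] [DecidableEq E] [Fintype V] [DecidableEq V]
  {R : Type*} [Field R] [LinearOrder R] [IsStrictOrderedRing R]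

section Iso

variable (ends : E → Sym2 V) (a₁ b v y : V) (p : E → R)

/-- The mass vector of an instance whose root `a₂` is isolated, in the order of `kmasses`:
`P(U∩X), P(U), P(Uᶜ), P(X∩Uᶜ), 0, 1, P(Uᶜ∩W∩(X ∪ C_v)), P(Uᶜ∩W), 0, 0`. -/
noncomputable def isoMasses : Fin 10 → R
  | 0 => prob p (connEvent ends a₁ v ∩ connEvent ends a₁ b)
  | 1 => prob p (connEvent ends a₁ v)
  | 2 => prob p (connEvent ends a₁ v)ᶜ
  | 3 => prob p (connEvent ends a₁ b ∩ (connEvent ends a₁ v)ᶜ)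
  | 4 => 0
  | 5 => 1
  | 6 => prob p ((connEvent ends a₁ v)ᶜ ∩ connEvent ends a₁ y ∩
      (connEvent ends a₁ b ∪ connEvent ends v b))
  | 7 => prob p ((connEvent ends a₁ v)ᶜ ∩ connEvent ends a₁ y)
  | 8 => 0
  | 9 => 0

end Iso

section Leaf

variable {ends : E → Sym2 V} {a₁ a₂ b v y z : V} {p : E → R} {e : E}

omit [Fintype E] [DecidableEq E] [Fintype V] [DecidableEq V] [Field R] [LinearOrder R]
  [IsStrictOrderedRing R] in
/-- With the leaf edge open, `x ↔ a₂` is `x ↔ z` (`x ≠ a₂`). -/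
lemma conn_leaf_of_open (hleaf : ∀ f, a₂ ∈ ends f → f = e) (hends : ends e = s(a₂, z))
    {ω : Config E} (ho : ω e = true) {x : V} (hx : x ≠ a₂) :
    Conn ends ω x a₂ ↔ Conn ends ω x z := by
  have h := Set.ext_iff.1 (connEvent_leaf_eq hleaf hends hx) ω
  simp only [mem_connEvent, Set.mem_inter_iff, mem_openEdge, ho, true_and] at h
  exact h

omit [Fintype E] [DecidableEq E] [Fintype V] [DecidableEq V] [Field R] [LinearOrder R]
  [IsStrictOrderedRing R] in
/-- With the leaf edge open, `a₂ ↔ x` is `z ↔ x` (`x ≠ a₂`). -/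
lemma conn_leaf_of_open' (hleaf : ∀ f, a₂ ∈ ends f → f = e) (hends : ends e = s(a₂, z))
    {ω : Config E} (ho : ω e = true) {x : V} (hx : x ≠ a₂) :
    Conn ends ω a₂ x ↔ Conn ends ω z x :=
  ⟨fun h => conn_symm ((conn_leaf_of_open hleaf hends ho hx).1 (conn_symm h)),
   fun h => conn_symm ((conn_leaf_of_open hleaf hends ho hx).2 (conn_symm h))⟩

omit [Fintype E] [DecidableEq E] [Fintype V] [DecidableEq V] [Field R] [LinearOrder R]
  [IsStrictOrderedRing R] in
/-- With the leaf edge closed, nothing else is connected to `a₂`. -/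
lemma not_conn_leaf_of_closed (hleaf : ∀ f, a₂ ∈ ends f → f = e) {ω : Config E}
    (hc : ω e = false) {x : V} (hx : x ≠ a₂) : ¬ Conn ends ω x a₂ :=
  fun h => hx (conn_eq_of_isolated hleaf hc (conn_symm h))

omit [Fintype E] [DecidableEq E] [Fintype V] [DecidableEq V] [Field R] [LinearOrder R]
  [IsStrictOrderedRing R] in
/-- With the leaf edge closed, `a₂` is connected to nothing else. -/
lemma not_conn_leaf_of_closed' (hleaf : ∀ f, a₂ ∈ ends f → f = e) {ω : Config E}
    (hc : ω e = false) {x : V} (hx : x ≠ a₂) : ¬ Conn ends ω a₂ x :=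
  fun h => not_conn_leaf_of_closed hleaf hc hx (conn_symm h)

omit [Fintype V] [IsStrictOrderedRing R] in
/-- The masses of the `a₂`-instance with the leaf edge pinned open are the masses of the
`z`-instance (with the edge pinned closed, where they are the same as at `p`). -/
theorem kmasses_update_one_rootLeaf (hleaf : ∀ f, a₂ ∈ ends f → f = e)
    (hends : ends e = s(a₂, z)) (h1 : a₁ ≠ a₂) (hb : b ≠ a₂) (hv : v ≠ a₂) (hy : y ≠ a₂)
    (hz : z ≠ a₂) (he : p e ≠ 1) :
    kmasses ends a₁ a₂ b v y (Function.update p e 1) =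
      kmasses ends a₁ z b v y (Function.update p e 0) := by
  -- flip invariance of the `z`-instance events
  have fU : FlipInvAt p e (connEvent ends a₁ v) := flipInvAt_connEvent hleaf hends h1 hv
  have fX : FlipInvAt p e (connEvent ends a₁ b) := flipInvAt_connEvent hleaf hends h1 hb
  have fW : FlipInvAt p e (connEvent ends a₁ y) := flipInvAt_connEvent hleaf hends h1 hy
  have fY : FlipInvAt p e (connEvent ends z y) := flipInvAt_connEvent hleaf hends hz hy
  have fCv : FlipInvAt p e (connEvent ends v b) := flipInvAt_connEvent hleaf hends hv hb
  have fΩ : FlipInvAt p e (Ω ends a₁ z) :=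
    flipInvAt_avoidAll hleaf hends h1 (by simpa using hz)
  have fS : FlipInvAt p e (S ends a₁ z v) := by
    refine flipInvAt_avoidAll hleaf hends hz ?_
    intro x hx
    simp only [Finset.mem_insert, Finset.mem_singleton] at hx
    rcases hx with rfl | rfl
    · exact h1
    · exact hv
  have fN : FlipInvAt p e (N ends a₁ z v) := by
    refine flipInvAt_avoidAll hleaf hends h1 ?_
    intro x hx
    simp only [Finset.mem_insert, Finset.mem_singleton] at hx
    rcases hx with rfl | rfl
    · exact hz
    · exact hv
  -- the generic step: `P_{p[e↦1]}(A) = P_{p[e↦0]}(A')` when `A ∩ {e open} = A' ∩ {e open}` and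
  -- `A'` is flip-invariant
  have key : ∀ {A A' : Set (Config E)}, A ∩ openEdge e = A' ∩ openEdge e → FlipInvAt p e A' →
      prob (Function.update p e 1) A = prob (Function.update p e 0) A' := by
    intro A A' hAA' hA'
    rw [← prob_update_one_inter_openEdge, hAA', prob_update_one_inter_openEdge,
      prob_update_one_eq_update_zero_of_flipInvAt he hA']
  funext k
  fin_cases k <;> simp only [kmasses] <;> refine key ?_ ?_
  · ext ω
    simp only [Set.mem_inter_iff, mem_connEvent, mem_Ω, mem_openEdge]
    constructor
    · rintro ⟨⟨⟨hU, hX⟩, hO⟩, ho⟩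
      exact ⟨⟨⟨hU, hX⟩, fun h => hO ((conn_leaf_of_open hleaf hends ho h1).2 h)⟩, ho⟩
    · rintro ⟨⟨⟨hU, hX⟩, hO⟩, ho⟩
      exact ⟨⟨⟨hU, hX⟩, fun h => hO ((conn_leaf_of_open hleaf hends ho h1).1 h)⟩, ho⟩
  · exact (fU.inter fX).inter fΩ
  · ext ω
    simp only [Set.mem_inter_iff, mem_connEvent, mem_Ω, mem_openEdge]
    constructor
    · rintro ⟨⟨hU, hO⟩, ho⟩
      exact ⟨⟨hU, fun h => hO ((conn_leaf_of_open hleaf hends ho h1).2 h)⟩, ho⟩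
    · rintro ⟨⟨hU, hO⟩, ho⟩
      exact ⟨⟨hU, fun h => hO ((conn_leaf_of_open hleaf hends ho h1).1 h)⟩, ho⟩
  · exact fU.inter fΩ
  · ext ω
    simp only [Set.mem_inter_iff, mem_N, mem_openEdge]
    constructor
    · rintro ⟨⟨hO, hU⟩, ho⟩
      exact ⟨⟨fun h => hO ((conn_leaf_of_open hleaf hends ho h1).2 h), hU⟩, ho⟩
    · rintro ⟨⟨hO, hU⟩, ho⟩
      exact ⟨⟨fun h => hO ((conn_leaf_of_open hleaf hends ho h1).1 h), hU⟩, ho⟩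
  · exact fN
  · ext ω
    simp only [Set.mem_inter_iff, mem_connEvent, mem_N, mem_openEdge]
    constructor
    · rintro ⟨⟨hX, hO, hU⟩, ho⟩
      exact ⟨⟨hX, fun h => hO ((conn_leaf_of_open hleaf hends ho h1).2 h), hU⟩, ho⟩
    · rintro ⟨⟨hX, hO, hU⟩, ho⟩
      exact ⟨⟨hX, fun h => hO ((conn_leaf_of_open hleaf hends ho h1).1 h), hU⟩, ho⟩
  · exact fX.inter fN
  · ext ω
    simp only [Set.mem_inter_iff, mem_connEvent, mem_S, mem_openEdge]
    constructor
    · rintro ⟨⟨hY, hO, hV⟩, ho⟩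
      exact ⟨⟨(conn_leaf_of_open' hleaf hends ho hy).1 hY,
        fun h => hO ((conn_leaf_of_open' hleaf hends ho h1).2 h),
        fun h => hV ((conn_leaf_of_open' hleaf hends ho hv).2 h)⟩, ho⟩
    · rintro ⟨⟨hY, hO, hV⟩, ho⟩
      exact ⟨⟨(conn_leaf_of_open' hleaf hends ho hy).2 hY,
        fun h => hO ((conn_leaf_of_open' hleaf hends ho h1).1 h),
        fun h => hV ((conn_leaf_of_open' hleaf hends ho hv).1 h)⟩, ho⟩
  · exact fY.inter fS
  · ext ω
    simp only [Set.mem_inter_iff, mem_S, mem_openEdge]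
    constructor
    · rintro ⟨⟨hO, hV⟩, ho⟩
      exact ⟨⟨fun h => hO ((conn_leaf_of_open' hleaf hends ho h1).2 h),
        fun h => hV ((conn_leaf_of_open' hleaf hends ho hv).2 h)⟩, ho⟩
    · rintro ⟨⟨hO, hV⟩, ho⟩
      exact ⟨⟨fun h => hO ((conn_leaf_of_open' hleaf hends ho h1).1 h),
        fun h => hV ((conn_leaf_of_open' hleaf hends ho hv).1 h)⟩, ho⟩
  · exact fS
  · ext ω
    simp only [cls01e, Set.mem_inter_iff, Set.mem_compl_iff, mem_connEvent, mem_S, mem_openEdge,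
      Set.mem_union]
    constructor
    · rintro ⟨⟨⟨⟨hU, hW⟩, hO, hV⟩, hXe⟩, ho⟩
      exact ⟨⟨⟨⟨hU, hW⟩, fun h => hO ((conn_leaf_of_open' hleaf hends ho h1).2 h),
        fun h => hV ((conn_leaf_of_open' hleaf hends ho hv).2 h)⟩, hXe⟩, ho⟩
    · rintro ⟨⟨⟨⟨hU, hW⟩, hO, hV⟩, hXe⟩, ho⟩
      exact ⟨⟨⟨⟨hU, hW⟩, fun h => hO ((conn_leaf_of_open' hleaf hends ho h1).1 h),
        fun h => hV ((conn_leaf_of_open' hleaf hends ho hv).1 h)⟩, hXe⟩, ho⟩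
  · exact ((fU.compl.inter fW).inter fS).inter (fX.union fCv)
  · ext ω
    simp only [cls01, Set.mem_inter_iff, Set.mem_compl_iff, mem_connEvent, mem_S, mem_openEdge]
    constructor
    · rintro ⟨⟨⟨hU, hW⟩, hO, hV⟩, ho⟩
      exact ⟨⟨⟨hU, hW⟩, fun h => hO ((conn_leaf_of_open' hleaf hends ho h1).2 h),
        fun h => hV ((conn_leaf_of_open' hleaf hends ho hv).2 h)⟩, ho⟩
    · rintro ⟨⟨⟨hU, hW⟩, hO, hV⟩, ho⟩
      exact ⟨⟨⟨hU, hW⟩, fun h => hO ((conn_leaf_of_open' hleaf hends ho h1).1 h),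
        fun h => hV ((conn_leaf_of_open' hleaf hends ho hv).1 h)⟩, ho⟩
  · exact (fU.compl.inter fW).inter fS
  · ext ω
    simp only [Set.mem_inter_iff, mem_connEvent, mem_Ω, mem_openEdge]
    constructor
    · rintro ⟨⟨⟨⟨hU, hY⟩, hX⟩, hO⟩, ho⟩
      exact ⟨⟨⟨⟨hU, (conn_leaf_of_open' hleaf hends ho hy).1 hY⟩, hX⟩,
        fun h => hO ((conn_leaf_of_open hleaf hends ho h1).2 h)⟩, ho⟩
    · rintro ⟨⟨⟨⟨hU, hY⟩, hX⟩, hO⟩, ho⟩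
      exact ⟨⟨⟨⟨hU, (conn_leaf_of_open' hleaf hends ho hy).2 hY⟩, hX⟩,
        fun h => hO ((conn_leaf_of_open hleaf hends ho h1).1 h)⟩, ho⟩
  · exact ((fU.inter fY).inter fX).inter fΩ
  · ext ω
    simp only [Set.mem_inter_iff, mem_connEvent, mem_Ω, mem_openEdge]
    constructor
    · rintro ⟨⟨⟨hU, hY⟩, hO⟩, ho⟩
      exact ⟨⟨⟨hU, (conn_leaf_of_open' hleaf hends ho hy).1 hY⟩,
        fun h => hO ((conn_leaf_of_open hleaf hends ho h1).2 h)⟩, ho⟩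
    · rintro ⟨⟨⟨hU, hY⟩, hO⟩, ho⟩
      exact ⟨⟨⟨hU, (conn_leaf_of_open' hleaf hends ho hy).2 hY⟩,
        fun h => hO ((conn_leaf_of_open hleaf hends ho h1).1 h)⟩, ho⟩
  · exact (fU.inter fY).inter fΩ

omit [Fintype V] [LinearOrder R] [IsStrictOrderedRing R] in
/-- The masses of the `a₂`-instance with the leaf edge pinned closed are the isolated masses. -/
theorem kmasses_update_zero_rootLeaf (hleaf : ∀ f, a₂ ∈ ends f → f = e) (h1 : a₁ ≠ a₂)
    (hv : v ≠ a₂) (hy : y ≠ a₂) :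
    kmasses ends a₁ a₂ b v y (Function.update p e 0) =
      isoMasses ends a₁ b v y (Function.update p e 0) := by
  have key : ∀ {A A' : Set (Config E)}, A ∩ closedEdge e = A' ∩ closedEdge e →
      prob (Function.update p e 0) A = prob (Function.update p e 0) A' := by
    intro A A' hAA'
    rw [← prob_update_zero_inter_closedEdge, hAA', prob_update_zero_inter_closedEdge]
  have hclosed : prob (Function.update p e 0) (closedEdge e) = 1 := by
    rw [prob_closedEdge]; simp
  funext k
  fin_cases k <;> simp only [isoMasses, kmasses]
  · refine key ?_
    ext ω
    simp only [Set.mem_inter_iff, mem_connEvent, mem_Ω, mem_closedEdge]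
    constructor
    · rintro ⟨⟨h, _⟩, hc⟩; exact ⟨h, hc⟩
    · rintro ⟨h, hc⟩; exact ⟨⟨h, not_conn_leaf_of_closed hleaf hc h1⟩, hc⟩
  · refine key ?_
    ext ω
    simp only [Set.mem_inter_iff, mem_connEvent, mem_Ω, mem_closedEdge]
    constructor
    · rintro ⟨⟨h, _⟩, hc⟩; exact ⟨h, hc⟩
    · rintro ⟨h, hc⟩; exact ⟨⟨h, not_conn_leaf_of_closed hleaf hc h1⟩, hc⟩
  · refine key ?_
    ext ω
    simp only [Set.mem_inter_iff, mem_N, Set.mem_compl_iff, mem_connEvent, mem_closedEdge]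
    constructor
    · rintro ⟨⟨_, h⟩, hc⟩; exact ⟨h, hc⟩
    · rintro ⟨h, hc⟩; exact ⟨⟨not_conn_leaf_of_closed hleaf hc h1, h⟩, hc⟩
  · refine key ?_
    ext ω
    simp only [Set.mem_inter_iff, mem_N, Set.mem_compl_iff, mem_connEvent, mem_closedEdge]
    constructor
    · rintro ⟨⟨hX, _, h⟩, hc⟩; exact ⟨⟨hX, h⟩, hc⟩
    · rintro ⟨⟨hX, h⟩, hc⟩; exact ⟨⟨hX, not_conn_leaf_of_closed hleaf hc h1, h⟩, hc⟩
  · rw [← prob_update_zero_inter_closedEdge]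
    have : connEvent ends a₂ y ∩ S ends a₁ a₂ v ∩ closedEdge e = ∅ := by
      rw [Set.eq_empty_iff_forall_notMem]
      rintro ω ⟨⟨hY, _⟩, hc⟩
      exact not_conn_leaf_of_closed' hleaf hc hy hY
    rw [this, prob_empty]
  · rw [← prob_update_zero_inter_closedEdge]
    have : S ends a₁ a₂ v ∩ closedEdge e = closedEdge e := by
      ext ω
      simp only [Set.mem_inter_iff, mem_S, mem_closedEdge, and_iff_right_iff_imp]
      intro hc
      exact ⟨not_conn_leaf_of_closed' hleaf hc h1, not_conn_leaf_of_closed' hleaf hc hv⟩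
    rw [this, hclosed]
  · refine key ?_
    ext ω
    simp only [cls01e, Set.mem_inter_iff, Set.mem_compl_iff, mem_connEvent, mem_S, mem_closedEdge,
      Set.mem_union]
    constructor
    · rintro ⟨⟨⟨⟨hU, hW⟩, _⟩, hXe⟩, hc⟩; exact ⟨⟨⟨hU, hW⟩, hXe⟩, hc⟩
    · rintro ⟨⟨⟨hU, hW⟩, hXe⟩, hc⟩
      exact ⟨⟨⟨⟨hU, hW⟩, not_conn_leaf_of_closed' hleaf hc h1,
        not_conn_leaf_of_closed' hleaf hc hv⟩, hXe⟩, hc⟩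
  · refine key ?_
    ext ω
    simp only [cls01, Set.mem_inter_iff, Set.mem_compl_iff, mem_connEvent, mem_S, mem_closedEdge]
    constructor
    · rintro ⟨⟨⟨hU, hW⟩, _⟩, hc⟩; exact ⟨⟨hU, hW⟩, hc⟩
    · rintro ⟨⟨hU, hW⟩, hc⟩
      exact ⟨⟨⟨hU, hW⟩, not_conn_leaf_of_closed' hleaf hc h1,
        not_conn_leaf_of_closed' hleaf hc hv⟩, hc⟩
  · rw [← prob_update_zero_inter_closedEdge]
    have : connEvent ends a₁ v ∩ connEvent ends a₂ y ∩ connEvent ends a₁ b ∩ Ω ends a₁ a₂ ∩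
        closedEdge e = ∅ := by
      rw [Set.eq_empty_iff_forall_notMem]
      rintro ω ⟨⟨⟨⟨_, hY⟩, _⟩, _⟩, hc⟩
      exact not_conn_leaf_of_closed' hleaf hc hy hY
    rw [this, prob_empty]
  · rw [← prob_update_zero_inter_closedEdge]
    have : connEvent ends a₁ v ∩ connEvent ends a₂ y ∩ Ω ends a₁ a₂ ∩ closedEdge e = ∅ := by
      rw [Set.eq_empty_iff_forall_notMem]
      rintro ω ⟨⟨⟨_, hY⟩, _⟩, hc⟩
      exact not_conn_leaf_of_closed' hleaf hc hy hY
    rw [this, prob_empty]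

omit [Fintype V] [IsStrictOrderedRing R] in
/-- **The root `a₂` on a leaf — the Bernstein split in the vocabulary of the `z`-instance.** -/
theorem kprimeForm_rootLeaf_a₂ (hleaf : ∀ f, a₂ ∈ ends f → f = e) (hends : ends e = s(a₂, z))
    (h1 : a₁ ≠ a₂) (hb : b ≠ a₂) (hv : v ≠ a₂) (hy : y ≠ a₂) (hz : z ≠ a₂) (he : p e ≠ 1) :
    kprimeForm ends a₁ a₂ b v y p (prob p (connEvent ends a₁ b ∩ N ends a₁ a₂ v))
        (prob p (N ends a₁ a₂ v)) =
      (1 - p e) ^ 3 * kformTri (isoMasses ends a₁ b v y (Function.update p e 0))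
          (isoMasses ends a₁ b v y (Function.update p e 0))
          (isoMasses ends a₁ b v y (Function.update p e 0)) +
        p e * (1 - p e) ^ 2 * mixedOne (isoMasses ends a₁ b v y (Function.update p e 0))
          (kmasses ends a₁ z b v y (Function.update p e 0)) +
        (p e) ^ 2 * (1 - p e) * mixedTwo (isoMasses ends a₁ b v y (Function.update p e 0))
          (kmasses ends a₁ z b v y (Function.update p e 0)) +
        (p e) ^ 3 * kprimeForm ends a₁ z b v y (Function.update p e 0)
          (prob (Function.update p e 0) (connEvent ends a₁ b ∩ N ends a₁ z v))
          (prob (Function.update p e 0) (N ends a₁ z v)) := by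
  rw [kprimeForm_bernstein_split ends a₁ a₂ b v y p e,
    kprimeForm_eq_kformTri ends a₁ a₂ b v y (Function.update p e 0),
    kprimeForm_eq_kformTri ends a₁ a₂ b v y (Function.update p e 1),
    kmasses_update_one_rootLeaf hleaf hends h1 hb hv hy hz he,
    kmasses_update_zero_rootLeaf hleaf h1 hv hy,
    ← kprimeForm_eq_kformTri ends a₁ z b v y (Function.update p e 0)]

omit [Fintype V] in
/-- **`(K′)` with the root `a₂` on a leaf** from `(K′)` at the `z`-instance and the three
root-leaf coefficients. -/
theorem kprime_of_rootLeaf_a₂ (hp : IsProbVec p) (hleaf : ∀ f, a₂ ∈ ends f → f = e)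
    (hends : ends e = s(a₂, z)) (h1 : a₁ ≠ a₂) (hb : b ≠ a₂) (hv : v ≠ a₂) (hy : y ≠ a₂)
    (hz : z ≠ a₂) (he : p e ≠ 1)
    (hF₀ : 0 ≤ kformTri (isoMasses ends a₁ b v y (Function.update p e 0))
      (isoMasses ends a₁ b v y (Function.update p e 0))
      (isoMasses ends a₁ b v y (Function.update p e 0)))
    (hG₁ : 0 ≤ mixedOne (isoMasses ends a₁ b v y (Function.update p e 0))
      (kmasses ends a₁ z b v y (Function.update p e 0)))
    (hG₂ : 0 ≤ mixedTwo (isoMasses ends a₁ b v y (Function.update p e 0))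
      (kmasses ends a₁ z b v y (Function.update p e 0)))
    (hF₁ : KPrimeHolds ends a₁ z b v y (Function.update p e 0)) :
    KPrimeHolds ends a₁ a₂ b v y p := by
  unfold KPrimeHolds at hF₁ ⊢
  rw [kprimeForm_rootLeaf_a₂ hleaf hends h1 hb hv hy hz he]
  have ht0 : 0 ≤ p e := hp.nonneg e
  have ht1 : 0 ≤ 1 - p e := sub_nonneg.2 (hp.le_one e)
  positivity

end Leaf

end KPrime

end Summit.Ventures.PercRepro2
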